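import Summits.ResolutionOfSingularities.ResolutionOfSingularities.Theorems.HilbertSamuelEliminationSigmaMaxModificationsCorridor3WLadderMovingTwoCensus6
import Summits.ResolutionOfSingularities.ResolutionOfSingularities.Theorems.HilbertSamuelEliminationSigmaMaxModificationsCorridor3WLadderE1GeneralSocket
import HarnessLib

/-!
# [OURS · L1 W4.2] CENSUS EDITION 7 OF THE β ROW `Wlow3TwoM` AND OF THE CONJUNCT: the OURS CLAIM `Corollary637_geomDir` LEAVES THE ROW —
# the `e = 1` third door at isolated starts is now a tree theorem in every embedding dimension (`E1Free.isoLowDirDimTerminatesFreeM_holds_of_doors`),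
# and the strata half reads Cor. 6.37 only in its PRINTED local form (`Corollary637_char`, a conjunct of `stub_printedFacts6`)
# (crux `SigmaMaxModifications` stmt-ResolutionOfSingularities-18506; conjunct `SigmaMaxModificationsCorridor3` stmt-…-19249; line `w_ladder_rows` v8.5;
# row `stub_twoClaims`; `--supports 19249`, helper)

Stub worker res-L1-w42-stub-3 (gen 6). Sorry-free PROOF file, no definition, no new named fact. OURS bookkeeping for the W4.2 crux chain
(cell res-hironaka); NOT a statement of [Hironaka2017] nor of [CossartJannsenSaito2020]. AI-written; AI review is weaker than expert review.
CONDITIONAL — credits nothing; the row's honest residue as ONE checkable statement.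

Edition 6 (`wlow3TwoM_census₆`, res-D-pv-038 p544544) read `∀ p, p.Prime → Wlow3TwoM p` from PRINTED {[H4] Th. IV, CJS Thm. 3.10 (4)} + the two
R_β OURS CLAIMS {`KeyTheorem640_localized_isolated`, `Corollary637_geomDir`}. The claim `Corollary637_geomDir` (CJS Cor. 6.37 under (F1♯)) entered
twice: (i) through `isoLowDirDimTerminatesFreeM_of_bridge` — the `e = 1` third door at ISOLATED starts; (ii) through `(corollary637_char_of_geomDir hC).toLoc`
in the strata half's bundle `LocalChainPrintedFacts` — local near-point chains on local schemes of dimension `≤ 2`, where (F1) HOLDS and the printed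
Cor. 6.37 (`Corollary637_char`) suffices. Edition 7 replaces (i) by the TREE THEOREM `E1Free.isoLowDirDimTerminatesFreeM_holds_of_doors` (every
embedding dimension: Hilbert-function freeness of `e = 1` near steps `…E1GeneralTransversal`, isolation persistence `…E1GeneralIsoPersistence`,
res-L1-w42-stub-2's arc limit in its grade-free form `…IsoTailsFreeRationalArcLimitLow`; doors `Theorem314_geomDir`, `Thm314_point_locus_geomDir` —
both from [H4] Th. IV — and Thm. 3.10 (4)) and (ii) by the printed `Corollary637_char` itself:

* **`Moving.wlow3TwoM_census₇ (h51 : Hironaka1970_thmIV) (h3104 : CossartJannsenSaito2020_thm_3_10_4) (hK : KeyTheorem640_localized_isolated)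
  (hC : Corollary637_char) : ∀ p, p.Prime → Wlow3TwoM p`** — THREE PRINTED FACTS + ONE OURS CLAIM (Thm. 6.40 for unit-wise localised chains
  with isolated initial parts, characteristic-free);
* `Residue.sigmaMaxModificationsCorridor3_of_printed_of_keyClaim_of_two_rows` — the conjunct from the four printed facts of edition 6's conjunct census,
  the ONE claim `KeyTheorem640_localized_isolated`, and the two W-top rows.

Consequence for the skeleton (lead-1 / plan-1 by name, not done here): v8.5's `stub_twoClaims : KeyTheorem640_localized_isolated ∧ Corollary637_geomDir`
may be re-typed as the single claim `KeyTheorem640_localized_isolated` (`Corollary637_char` is already a conjunct of `stub_printedFacts6`).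
References (prose): CJS LNM 2270 Thm. 3.10 (4), Thm. 3.14, Def. 6.34, Cor. 6.37, Def. 6.38, Thm. 6.40; Hironaka 1970 Th. IV.
[cite: CossartJannsenSaito2020, Thm. 3.10 (4), Thm. 3.14, Def. 6.34, Cor. 6.37, Def. 6.38, Thm. 6.40] [cite: Hironaka1970NumericalCharacters, Th. IV]
-/

noncomputable section

set_option linter.dupNamespace false -- namespace `…Corridor3.Moving` re-enters `…Corridor3` (module convention of the Moving files)

open CategoryTheory AlgebraicGeometry TopologicalSpace Topology IsLocalRing
open Summit.ResolutionOfSingularities.ResolutionOfSingularities.Theorems.CampaignW42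
open Literature.AlgebraicGeometry.Resolution Literature.RingTheory.HilbertSamuel
open Literature.AlgebraicGeometry.CossartJannsenSaito2020
open Summit.ResolutionOfSingularities.ResolutionOfSingularities.Theses.HilbertSamuelElimination
open Summit.ResolutionOfSingularities.ResolutionOfSingularities.Theorems.SigmaMaxModificationsCorridor3

namespace Summit.ResolutionOfSingularities.ResolutionOfSingularities.Theorems.SigmaMaxModificationsCorridor3.Moving

/-- **CENSUS EDITION 7 OF THE β ROW: `∀ p, p.Prime → Wlow3TwoM p` from [H4] Th. IV, CJS Thm. 3.10 (4), the PRINTED Cor. 6.37 (`Corollary637_char`)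
and the ONE R_β OURS CLAIM `KeyTheorem640_localized_isolated`** — edition 6 with the isolated-start third door supplied by the tree theorem
`E1Free.isoLowDirDimTerminatesFreeM_holds_of_doors` (every embedding dimension) instead of `Corollary637_geomDir`, and the strata half's Cor. 6.37 read in
print. CONDITIONAL — credits nothing. [cite: CossartJannsenSaito2020, Thm. 3.10 (4), Thm. 3.14, Def. 6.34, Cor. 6.37, Def. 6.38, Thm. 6.40]
[cite: Hironaka1970NumericalCharacters, Th. IV] -/
theorem wlow3TwoM_census₇
    (h51 : Hironaka1970_thmIV.{0}) (h3104 : CossartJannsenSaito2020_thm_3_10_4.{0})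
    (hK : KeyTheorem640_localized_isolated.{0}) (hC : Corollary637_char.{0}) :
    ∀ p : ℕ, p.Prime → Wlow3TwoM.{0} p :=
  have hF314 : Theorem314_geomDir.{0} :=
    Directrix214Sharp.theorem314_geomDir_of_thmIV_of_split h51 HerrmannIkedaOrbanz1988_cor_21_11_holds
  have h314gd : Thm314_point_locus_geomDir.{0} :=
    Directrix214Sharp.thm314_point_locus_geomDir_of_thmIV_point (Hironaka1970_thmIV_point_of_thmIV h51)
  stub_Wlow3M_two_of_two
    (wlow3TwoM_of_wlowM
      (wlowM_assembled_locFree hK (E1Free.isoLowDirDimTerminatesFreeM_holds_of_doors hF314 h3104 h314gd 2)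
        (Seg.unitTowerExtractionLocFreeM_of_geomDirFacts 2 hF314 (theorem314_nearFibre_geomDir_of_thmIV h51) h314gd
          CossartJannsenSaito2020_thm_3_6_holds h3104)
        (wlowStrataM_of_thmIV_localChainPrintedFacts h51
          (localChainPrintedFacts_of_thmIV hC.toLoc (keyTheorem640_char_localized_isolated_of_free' hK) h3104 h51))))

end Summit.ResolutionOfSingularities.ResolutionOfSingularities.Theorems.SigmaMaxModificationsCorridor3.Moving

namespace Summit.ResolutionOfSingularities.ResolutionOfSingularities.Theorems.SigmaMaxModificationsCorridor3.Residue

open Summit.ResolutionOfSingularities.ResolutionOfSingularities.Theorems.SigmaMaxModificationsCorridor3.Moving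

/-- **CENSUS OF THE CONJUNCT `SigmaMaxModificationsCorridor3` (edition 7): FIVE PRINTED FACTS + ONE R_β OURS CLAIM + TWO OURS ROWS** ⟸ PRINTED
{`CossartJannsenSaito2020_nuElimination`, `CossartJannsenSaito2020SequencePermissible`, `CossartJannsenSaito2020_thm_3_10_4`, `Hironaka1970_thmIV`,
`Corollary637_char`} + OURS CLAIM {`KeyTheorem640_localized_isolated`} + OURS ROWS {`Wtop3PointedM`, `Wtop3NonpointedM`} — res-L1-w42-stub-4's
`sigmaMaxModificationsCorridor3_of_printed_of_three_rows` with the row `Wlow3TwoM` supplied by `Moving.wlow3TwoM_census₇`. CONDITIONAL — credits nothing.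
[cite: CossartJannsenSaito2020, Thm. 3.10 (4), Thm. 5.17, Cor. 6.37, Thm. 6.40] [cite: Hironaka1970NumericalCharacters, Th. IV] -/
theorem sigmaMaxModificationsCorridor3_of_printed_of_keyClaim_of_two_rows
    (hNu : CossartJannsenSaito2020_nuElimination.{0}) (hSeq : CossartJannsenSaito2020SequencePermissible.{0})
    (h310 : CossartJannsenSaito2020_thm_3_10_4.{0}) (h51 : Hironaka1970_thmIV.{0}) (hC : Corollary637_char.{0})
    (hK : KeyTheorem640_localized_isolated.{0})
    (hTopP : ∀ p : ℕ, p.Prime → Wtop3PointedM.{0} p) (hTopN : ∀ p : ℕ, p.Prime → Wtop3NonpointedM.{0} p) :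
    SigmaMaxModificationsCorridor3 :=
  sigmaMaxModificationsCorridor3_of_printed_of_three_rows hNu hSeq h310 (keyTheorem640_char_localized_isolated_of_free hK)
    hC h51 (wlow3TwoM_census₇ h51 h310 hK hC) hTopP hTopN

end Summit.ResolutionOfSingularities.ResolutionOfSingularities.Theorems.SigmaMaxModificationsCorridor3.Residue

end
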